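import Mathlib
import Literature.NumberTheory.LFunctions.Zhang2022.Section4Line48TildeZ
import HarnessLib

/-!
# Zhang (2022) §4, proof of (4.8): the pointwise majorants of the shifted Perron integrand
# `Z̃(s+w,ψ)(Σ_{D⁴<n≤P²}ν(n)ψ̄(n)n^{−(1−s−w)})P^{(9/5)w}ω₁(w)/w` on the contour of (4.8)
# (DAG `Z22:§4.u033`–`u034`, locator [Z22 p.20, tex L1104–L1110])

Topic `Literature/NumberTheory/LFunctions/Zhang2022` (Landau–Siegel audit tree; verdict-neutral).
Y. Zhang, *Discrete mean estimates and the Landau–Siegel zero*, arXiv:2211.02515v1 (2022)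
[Zhang2022LandauSiegel] — **an unrefereed manuscript under adjudication; nothing here asserts or
denies its Theorems 1–2.** Campaign D-0069 (discharge lane, seat d05), §4 p. 20:

> By a trivial bound for `ω₁(w)` and (4.5) we see that the left side of (4.8) is
> `≪ P^{1−2σ}∫_{−𝓛²⁰}^{𝓛²⁰} |Σ_{D⁴<n≤P²} ν(n)ψ(n)n^{−(s*+iv)}| dv/(α+iv) + ε` with `s* = 1 + α − s̄`.

This THEOREM-ONLY file (second of three) makes "a trivial bound for `ω₁(w)` and (4.5)" explicit,
POINTWISE on the three kinds of pieces of the shifted contour of (4.8) (`Section4.perronContour`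
with `a = −σ−½`, `b = −α`, `V = 𝓛²⁰`), for `s` in the wide strip `Ω₃′` (`½ − 3α < σ < 1 + α`,
`|t − 2πt₀| < 𝓛₁ + 3`) and `𝓛 ≥ 4`:

* `norm_perronIntegrand_f48_mid_le` — on the ray `w = −α + iv`, `|v| ≤ 𝓛²⁰`:
  `‖…‖ ≤ 2e^{2π+3}·P^{1−2σ}·|Σ_{D⁴<n≤P²} ν(n)ψ(n)n^{−(s*+iv)}|/|α+iv|`
  (`|P^{(9/5)w}| = P^{−9α/5} ≤ 1`, `|ω₁(−α+iv)| ≤ e^{α²/4𝓛³⁰} ≤ e`, `|−α+iv| = |α+iv|`);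
* `norm_perronIntegrand_f48_horiz_le` — on the horizontal segments `w = u ± i𝓛²⁰`:
  `‖…‖ ≤ 2e^{2𝓛⁹+1045𝓛}·P⁴·e^{1−𝓛¹⁰/4}` (`|ω₁(u ± i𝓛²⁰)| ≤ e^{1/𝓛³⁰−𝓛¹⁰/4}`, `|w| ≥ 𝓛²⁰`);
* `norm_perronIntegrand_f48_tail_le` — on the tails `w = −σ−½ + iv`, `|v| ≥ 𝓛²⁰`:
  `‖…‖ ≤ 1568e·Dp²𝓛¹⁰⁴⁸P⁴·e^{−|v|/(8𝓛¹⁰)}` (`e^{−v²/4𝓛³⁰} ≤ e^{−|v|/4𝓛¹⁰}`, `|w| ≥ |v|`);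
* `tail_prefactor_le`, `horiz_prefactor_le` — the exponent bookkeeping `… ≤ C·e^{−𝓛¹⁰/16}` for
  `𝓛 ≥ 144` (`ε = exp(−𝓛¹⁰/16)`).

The integration and the typed node `Section4.Line48Bound` / `Ded48a` follow in
`Section4Line48Bound.lean`. No definition, no new named fact.

## References

* Y. Zhang, arXiv:2211.02515v1 (2022), §4 p. 20, proof of (4.8); (4.5) p. 18; (2.6), (2.8), (2.10).
  [cite: Zhang2022LandauSiegel, §4 (4.8) (proof) p. 20]
-/

noncomputable section

open Complex Real ComplexConjugate MeasureTheory Set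

namespace Literature.NumberTheory.LFunctions.Zhang2022.Section4

open Skeleton

/-! ## The Perron integrand of (4.8) on the three kinds of pieces of the contour -/

section Integrand

variable {D : ℕ} [NeZero D] (χ : DirichletCharacter ℂ D)

/-- `a·e^{−a/(4L)} ≤ 8L·e^{−a/(8L)}` for `a ≥ 0`, `L > 0` (`y ≤ e^y` with `y = a/8L`). [folklore] -/
private theorem mul_exp_le_l48 {L a : ℝ} (hL : 0 < L) (ha : 0 ≤ a) :
    a * Real.exp (-a / (4 * L)) ≤ 8 * L * Real.exp (-a / (8 * L)) := by
  set y : ℝ := a / (8 * L) with hy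
  have hy0 : 0 ≤ y := by positivity
  have ha' : a = 8 * L * y := by rw [hy]; field_simp
  have h2 : Real.exp (-a / (4 * L)) = Real.exp (-y) * Real.exp (-y) := by
    rw [← Real.exp_add]; congr 1; rw [ha']; field_simp; ring
  have h3 : Real.exp (-a / (8 * L)) = Real.exp (-y) := by
    congr 1; rw [ha']; field_simp
  rw [h2, h3, ha']
  have hyexp : y ≤ Real.exp y := by have := Real.add_one_le_exp y; linarith
  have hE : 0 < Real.exp (-y) := Real.exp_pos _
  have hEE : Real.exp y * Real.exp (-y) = 1 := by
    rw [← Real.exp_add, add_neg_cancel, Real.exp_zero]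
  calc 8 * L * y * (Real.exp (-y) * Real.exp (-y))
      ≤ 8 * L * Real.exp y * (Real.exp (-y) * Real.exp (-y)) := by gcongr
    _ = 8 * L * (Real.exp y * Real.exp (-y)) * Real.exp (-y) := by ring
    _ = 8 * L * Real.exp (-y) := by rw [hEE, mul_one]

/-- **The integrand on the ray `w = −α + iv`, `|v| ≤ 𝓛²⁰`** ("by a trivial bound for `ω₁(w)` and
(4.5)"): for `𝓛 ≥ 4`, `D ≥ 3`, `χ` real primitive, `s ∈ Ω₃′`:
`‖Z̃(s+w)·(Σν(n)ψ̄(n)n^{−(1−s−w)})·P^{(9/5)w}ω₁(w)/w‖ ≤ 2e^{2π+3}·P^{1−2σ}·|Σ_{D⁴<n≤P²}ν(n)ψ(n)n^{−(s*+iv)}|/|α+iv|`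
(`|P^{(9/5)w}| = P^{−9α/5} ≤ 1`, `|ω₁(−α+iv)| ≤ e^{α²/4𝓛³⁰} ≤ e`, `|−α+iv| = |α+iv|`).
[cite: Zhang2022LandauSiegel, §4 (4.8) (proof) p. 20] -/
theorem norm_perronIntegrand_f48_mid_le (hℓ : 4 ≤ ell D) (hD3 : 3 ≤ D) (hq : χ.IsQuadratic)
    (hχ : χ.IsPrimitive) (x : Chr D) {s : ℂ} (hσ1 : 1 / 2 - 3 * alpha D < s.re)
    (hσ2 : s.re < 1 + alpha D) (ht : |s.im - 2 * π * t0 D| < ell1 D + 3) {v : ℝ}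
    (hv : |v| ≤ ell D ^ 20) :
    ‖perronIntegrand D (f48 χ x s) (((-alpha D : ℝ) : ℂ) + v * I)‖
      ≤ 2 * Real.exp (2 * π + 3) * bigP D ^ (1 - 2 * s.re) *
        (‖∑ n ∈ Finset.Ioc (D ^ 4) ⌊bigP D ^ 2⌋₊,
            nu χ n * x.ψ (n : ZMod x.p) * (n : ℂ) ^ (-(sStar D s + v * I))‖
          / ‖(alpha D : ℂ) + v * I‖) := by
  obtain ⟨hα0, hα8, -, hP1⟩ := alpha_facts_of_four_le_ell hℓ
  have hℓ0 : 0 < ell D := by linarith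
  have hZ := norm_tildeZW_ray_le χ hℓ hD3 hχ x hσ1 hσ2 ht hv
  have hM := norm_midSum_ray_eq χ hq x s v
  rw [norm_perronIntegrand]
  set w : ℂ := ((-alpha D : ℝ) : ℂ) + v * I with hw
  set S : ℂ := ∑ n ∈ Finset.Ioc (D ^ 4) ⌊bigP D ^ 2⌋₊,
      nu χ n * x.ψ (n : ZMod x.p) * (n : ℂ) ^ (-(sStar D s + v * I)) with hS
  have hf : ‖f48 χ x s w‖ = ‖tildeZW χ x (s + w)‖ * ‖S‖ := by
    rw [show f48 χ x s w = tildeZW χ x (s + w) * midSum χ x (1 - s - w) from rfl, norm_mul, hM]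
  have hPfac : bigP D ^ ((9 / 5 : ℝ) * (-alpha D)) ≤ 1 :=
    Real.rpow_le_one_of_one_le_of_nonpos hP1 (by nlinarith)
  have hEfac : Real.exp (((-alpha D) ^ 2 - v ^ 2) / (4 * ell D ^ 30)) ≤ Real.exp 1 := by
    refine Real.exp_le_exp.mpr ?_
    rw [div_le_one (by positivity)]
    have h30 : (1 : ℝ) ≤ ell D ^ 30 := one_le_pow₀ (by linarith)
    nlinarith [sq_nonneg v]
  have hnorm : ‖w‖ = ‖(alpha D : ℂ) + v * I‖ := by
    rw [hw, Complex.norm_eq_sqrt_sq_add_sq, Complex.norm_eq_sqrt_sq_add_sq]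
    congr 1
    simp [sq]
  rw [hf, hnorm]
  calc ‖tildeZW χ x (s + w)‖ * ‖S‖ * bigP D ^ ((9 / 5 : ℝ) * (-alpha D)) *
        Real.exp (((-alpha D) ^ 2 - v ^ 2) / (4 * ell D ^ 30)) / ‖(alpha D : ℂ) + v * I‖
      ≤ 2 * Real.exp (2 * π + 2) * bigP D ^ (1 - 2 * s.re) * ‖S‖ * 1 * Real.exp 1
          / ‖(alpha D : ℂ) + v * I‖ := by gcongr
    _ = 2 * Real.exp (2 * π + 3) * bigP D ^ (1 - 2 * s.re) * (‖S‖ / ‖(alpha D : ℂ) + v * I‖) := by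
        rw [show (2 * π + 3 : ℝ) = (2 * π + 2) + 1 by ring, Real.exp_add (2 * π + 2) 1]; ring

/-- **The integrand on the horizontal segments `w = u ± i𝓛²⁰`, `−σ−½ ≤ u ≤ −α`** ("a trivial bound
for `ω₁(w)`"): for `𝓛 ≥ 4`, `D ≥ 3`, `χ` primitive, `s ∈ Ω₃′`:
`‖…‖ ≤ 2e^{2𝓛⁹+1045𝓛}·P⁴·e^{1−𝓛¹⁰/4}` (`|Z̃| ≤ 2e^{2𝓛⁹+1045𝓛}`, `|Σ…| ≤ Σ|ν| ≤ P⁴`,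
`|P^{(9/5)w}| ≤ 1`, `|ω₁(u ± i𝓛²⁰)| = e^{(u²−𝓛⁴⁰)/4𝓛³⁰} ≤ e^{1−𝓛¹⁰/4}`, `|w| ≥ 𝓛²⁰ ≥ 1`).
[cite: Zhang2022LandauSiegel, §4 (4.8) (proof) p. 20] -/
theorem norm_perronIntegrand_f48_horiz_le (hℓ : 4 ≤ ell D) (hD3 : 3 ≤ D) (hχ : χ.IsPrimitive)
    (x : Chr D) {s : ℂ} (hσ1 : 1 / 2 - 3 * alpha D < s.re) (hσ2 : s.re < 1 + alpha D)
    (ht : |s.im - 2 * π * t0 D| < ell1 D + 3) {u V' : ℝ} (hu1 : -s.re - 1 / 2 ≤ u)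
    (hu2 : u ≤ -alpha D) (hV' : |V'| = ell D ^ 20) :
    ‖perronIntegrand D (f48 χ x s) ((u : ℂ) + V' * I)‖
      ≤ 2 * Real.exp (2 * ell D ^ 9 + 1045 * ell D) * bigP D ^ 4 *
          Real.exp (1 - ell D ^ 10 / 4) := by
  obtain ⟨hα0, hα8, -, hP1⟩ := alpha_facts_of_four_le_ell hℓ
  have hℓ0 : 0 < ell D := by linarith
  have hℓ1 : 1 ≤ ell D := by linarith
  have hV'le : |V'| ≤ ell D ^ 20 := hV'.le
  have hZ := norm_tildeZW_horiz_le χ hℓ hD3 hχ x hσ2 ht hu1 hu2 hV'le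
  rw [norm_perronIntegrand]
  set w : ℂ := (u : ℂ) + V' * I with hw
  have hzre : 0 ≤ (1 - s - w).re := by simp [hw]; linarith
  have hmid : ‖midSum χ x (1 - s - w)‖ ≤ bigP D ^ 4 :=
    (norm_midSum_le_sum_norm χ x hzre).trans (sum_norm_nu_le_bigP_pow_four χ)
  have hf : ‖f48 χ x s w‖ ≤ 2 * Real.exp (2 * ell D ^ 9 + 1045 * ell D) * bigP D ^ 4 := by
    rw [show f48 χ x s w = tildeZW χ x (s + w) * midSum χ x (1 - s - w) from rfl, norm_mul]
    exact mul_le_mul hZ hmid (norm_nonneg _) (by positivity)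
  have hPfac : bigP D ^ ((9 / 5 : ℝ) * u) ≤ 1 :=
    Real.rpow_le_one_of_one_le_of_nonpos hP1 (by nlinarith)
  have hEfac : Real.exp ((u ^ 2 - V' ^ 2) / (4 * ell D ^ 30)) ≤ Real.exp (1 - ell D ^ 10 / 4) := by
    refine Real.exp_le_exp.mpr ?_
    rw [div_le_iff₀ (by positivity)]
    have hV2 : V' ^ 2 = ell D ^ 40 := by rw [← sq_abs, hV']; ring
    have hu2' : u ^ 2 ≤ 4 := by nlinarith
    have h30 : (1 : ℝ) ≤ ell D ^ 30 := one_le_pow₀ hℓ1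
    have e40 : ell D ^ 40 = ell D ^ 10 * ell D ^ 30 := by ring
    rw [hV2, e40]
    nlinarith
  have hw1 : 1 ≤ ‖w‖ := by
    have h := Complex.abs_im_le_norm w
    have : |V'| ≤ ‖w‖ := by simpa [hw] using h
    rw [hV'] at this
    exact (one_le_pow₀ hℓ1).trans this
  calc ‖f48 χ x s w‖ * bigP D ^ ((9 / 5 : ℝ) * u) * Real.exp ((u ^ 2 - V' ^ 2) / (4 * ell D ^ 30))
        / ‖w‖
      ≤ ‖f48 χ x s w‖ * bigP D ^ ((9 / 5 : ℝ) * u) *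
          Real.exp ((u ^ 2 - V' ^ 2) / (4 * ell D ^ 30)) := div_le_self (by positivity) hw1
    _ ≤ 2 * Real.exp (2 * ell D ^ 9 + 1045 * ell D) * bigP D ^ 4 * 1 *
          Real.exp (1 - ell D ^ 10 / 4) := by gcongr
    _ = _ := by ring

/-- **The integrand on the tails `w = −σ−½ + iv`, `|v| ≥ 𝓛²⁰`** ("a trivial bound for `ω₁(w)`"):
for `𝓛 ≥ 4`, `D ≥ 3`, `χ` primitive, `s ∈ Ω₃′`:
`‖…‖ ≤ 1568e·Dp²·𝓛¹⁰⁴⁸·P⁴·e^{−|v|/(8𝓛¹⁰)}` (`|Z̃(s+w)| ≤ 196Dp²𝓛¹⁰³⁸v²` on `Re = −½`,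
`|Σ…| ≤ P⁴`, `|ω₁| ≤ e·e^{−|v|/(4𝓛¹⁰)}` as `v² ≥ 𝓛²⁰|v|`, `|w| ≥ |v|`, `|v|e^{−|v|/4𝓛¹⁰} ≤ 8𝓛¹⁰e^{−|v|/8𝓛¹⁰}`).
[cite: Zhang2022LandauSiegel, §4 (4.8) (proof) p. 20] -/
theorem norm_perronIntegrand_f48_tail_le (hℓ : 4 ≤ ell D) (hD3 : 3 ≤ D) (hχ : χ.IsPrimitive)
    (x : Chr D) {s : ℂ} (hσ1 : 1 / 2 - 3 * alpha D < s.re) (hσ2 : s.re < 1 + alpha D)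
    (ht : |s.im - 2 * π * t0 D| < ell1 D + 3) {v : ℝ} (hv : ell D ^ 20 ≤ |v|) :
    ‖perronIntegrand D (f48 χ x s) (((-s.re - 1 / 2 : ℝ) : ℂ) + v * I)‖
      ≤ 1568 * Real.exp 1 * ((D : ℝ) * (x.p : ℝ) ^ 2) * ell D ^ 1048 * bigP D ^ 4 *
          Real.exp (-|v| / (8 * ell D ^ 10)) := by
  obtain ⟨hα0, hα8, -, hP1⟩ := alpha_facts_of_four_le_ell hℓ
  have hℓ0 : 0 < ell D := by linarith
  have hℓ1 : 1 ≤ ell D := by linarith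
  have hZ := norm_tildeZW_tail_le χ (by linarith) hD3 hχ x ht hv
  rw [norm_perronIntegrand]
  set a : ℝ := -s.re - 1 / 2 with ha
  set w : ℂ := (a : ℂ) + v * I with hw
  have h20 : (1 : ℝ) ≤ ell D ^ 20 := one_le_pow₀ hℓ1
  have hv1 : 1 ≤ |v| := h20.trans hv
  have hv0 : 0 < |v| := by linarith
  have hzre : 0 ≤ (1 - s - w).re := by simp [hw, ha]; linarith
  have hmid : ‖midSum χ x (1 - s - w)‖ ≤ bigP D ^ 4 :=
    (norm_midSum_le_sum_norm χ x hzre).trans (sum_norm_nu_le_bigP_pow_four χ)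
  have hf : ‖f48 χ x s w‖ ≤ 196 * ((D : ℝ) * (x.p : ℝ) ^ 2) * ell D ^ 1038 * v ^ 2 * bigP D ^ 4 := by
    rw [show f48 χ x s w = tildeZW χ x (s + w) * midSum χ x (1 - s - w) from rfl, norm_mul]
    exact mul_le_mul hZ hmid (norm_nonneg _) (by positivity)
  have hPfac : bigP D ^ ((9 / 5 : ℝ) * a) ≤ 1 :=
    Real.rpow_le_one_of_one_le_of_nonpos hP1 (by rw [ha]; nlinarith)
  have hEfac : Real.exp ((a ^ 2 - v ^ 2) / (4 * ell D ^ 30))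
      ≤ Real.exp 1 * Real.exp (-|v| / (4 * ell D ^ 10)) := by
    rw [← Real.exp_add]
    refine Real.exp_le_exp.mpr ?_
    rw [div_le_iff₀ (by positivity)]
    have ha2 : a ^ 2 ≤ 4 := by rw [ha]; nlinarith
    have hvsq : ell D ^ 20 * |v| ≤ v ^ 2 := by
      calc ell D ^ 20 * |v| ≤ |v| * |v| := mul_le_mul_of_nonneg_right hv hv0.le
        _ = v ^ 2 := by rw [← sq, sq_abs]
    have h30 : (1 : ℝ) ≤ ell D ^ 30 := one_le_pow₀ hℓ1
    have e : (1 + -|v| / (4 * ell D ^ 10)) * (4 * ell D ^ 30)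
        = 4 * ell D ^ 30 - |v| * ell D ^ 20 := by
      field_simp
      ring
    rw [e]
    nlinarith
  have hwv : |v| ≤ ‖w‖ := by
    have h := Complex.abs_im_le_norm w
    simpa [hw] using h
  have hsqdiv : v ^ 2 / |v| = |v| := by
    rw [← sq_abs, sq, mul_div_assoc, div_self hv0.ne', mul_one]
  calc ‖f48 χ x s w‖ * bigP D ^ ((9 / 5 : ℝ) * a) * Real.exp ((a ^ 2 - v ^ 2) / (4 * ell D ^ 30))
        / ‖w‖
      ≤ ‖f48 χ x s w‖ * bigP D ^ ((9 / 5 : ℝ) * a) *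
          Real.exp ((a ^ 2 - v ^ 2) / (4 * ell D ^ 30)) / |v| :=
        div_le_div_of_nonneg_left (by positivity) hv0 hwv
    _ ≤ 196 * ((D : ℝ) * (x.p : ℝ) ^ 2) * ell D ^ 1038 * v ^ 2 * bigP D ^ 4 * 1 *
          (Real.exp 1 * Real.exp (-|v| / (4 * ell D ^ 10))) / |v| := by gcongr
    _ = 196 * Real.exp 1 * ((D : ℝ) * (x.p : ℝ) ^ 2) * ell D ^ 1038 * bigP D ^ 4 *
          (v ^ 2 / |v| * Real.exp (-|v| / (4 * ell D ^ 10))) := by ring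
    _ = 196 * Real.exp 1 * ((D : ℝ) * (x.p : ℝ) ^ 2) * ell D ^ 1038 * bigP D ^ 4 *
          (|v| * Real.exp (-|v| / (4 * ell D ^ 10))) := by rw [hsqdiv]
    _ ≤ 196 * Real.exp 1 * ((D : ℝ) * (x.p : ℝ) ^ 2) * ell D ^ 1038 * bigP D ^ 4 *
          (8 * ell D ^ 10 * Real.exp (-|v| / (8 * ell D ^ 10))) :=
        mul_le_mul_of_nonneg_left (mul_exp_le_l48 (pow_pos hℓ0 10) hv0.le) (by positivity)
    _ = 1568 * Real.exp 1 * ((D : ℝ) * (x.p : ℝ) ^ 2) * ell D ^ 1048 * bigP D ^ 4 *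
          Real.exp (-|v| / (8 * ell D ^ 10)) := by ring

end Integrand

/-! ## The exponent bookkeeping: everything off the ray is `≪ e^{−𝓛¹⁰/16}` for `𝓛 ≥ 144` -/

section Prefactors

variable {D : ℕ}

/-- `𝓛ⁿ ≤ e^{n𝓛}` for `𝓛 ≥ 0`. [folklore] -/
private theorem pow_le_exp_mul_l48 {L : ℝ} (hL : 0 ≤ L) (n : ℕ) : L ^ n ≤ Real.exp (n * L) := by
  have h1 : L ≤ Real.exp L := by have := Real.add_one_le_exp L; linarith
  calc L ^ n ≤ (Real.exp L) ^ n := pow_le_pow_left₀ hL h1 n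
    _ = Real.exp (n * L) := by rw [← Real.exp_nat_mul]

/-- `D = e^{𝓛}` once `𝓛 > 0`. [cite: Zhang2022LandauSiegel, §2 (2.1)] -/
private theorem natCast_eq_exp_ell_l48 (hℓ : 0 < ell D) : (D : ℝ) = Real.exp (ell D) := by
  have hD1 : (1 : ℝ) < D := by
    by_contra h
    push Not at h
    have := Real.log_nonpos (Nat.cast_nonneg D) h
    exact absurd this (not_le.mpr hℓ)
  rw [ell, Real.exp_log (by linarith)]

/-- **The tails are `≪ ε`**: for `𝓛 ≥ 144`,
`1568e·Dp²𝓛¹⁰⁴⁸P⁴·(8𝓛¹⁰e^{−𝓛¹⁰/8}) ≤ 112896e·e^{−𝓛¹⁰/16}` (`D = e^𝓛`, `p² ≤ 9P²`, `P⁴ = e^{4𝓛⁹}`,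
`𝓛¹⁰⁵⁸ ≤ e^{1058𝓛}`, and `1059𝓛 + 6𝓛⁹ ≤ 𝓛¹⁰/16`). [cite: Zhang2022LandauSiegel, §4 (4.8) (proof) p. 20] -/
theorem tail_prefactor_le (hℓ : 144 ≤ ell D) (x : Chr D) :
    1568 * Real.exp 1 * ((D : ℝ) * (x.p : ℝ) ^ 2) * ell D ^ 1048 * bigP D ^ 4 *
        (8 * ell D ^ 10 * Real.exp (-(ell D ^ 10) / 8))
      ≤ 112896 * Real.exp 1 * Real.exp (-(ell D ^ 10) / 16) := by
  have hℓ0 : 0 < ell D := by linarith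
  have hℓ1 : 1 ≤ ell D := by linarith
  obtain ⟨-, hp2⟩ := bigP_lt_p_le hℓ1 x
  have hP : 0 < bigP D := Real.exp_pos _
  have hD : (D : ℝ) = Real.exp (ell D) := natCast_eq_exp_ell_l48 hℓ0
  have hp2' : (x.p : ℝ) ^ 2 ≤ 9 * Real.exp (2 * ell D ^ 9) := by
    calc (x.p : ℝ) ^ 2 ≤ (3 * bigP D) ^ 2 := pow_le_pow_left₀ (by positivity) hp2 2
      _ = 9 * Real.exp (2 * ell D ^ 9) := by
          rw [mul_pow, bigP, ← Real.exp_nat_mul]; norm_num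
  have h1058 : ell D ^ 1058 ≤ Real.exp (1058 * ell D) := by
    have := pow_le_exp_mul_l48 hℓ0.le 1058; norm_num at this; exact this
  have hP4 : bigP D ^ 4 = Real.exp (4 * ell D ^ 9) := by
    rw [bigP, ← Real.exp_nat_mul]; norm_num
  have h8 : (1059 : ℝ) ≤ ell D ^ 8 := by
    calc (1059 : ℝ) ≤ 144 ^ 8 := by norm_num
      _ ≤ ell D ^ 8 := pow_le_pow_left₀ (by norm_num) hℓ 8
  have e9 : ell D ^ 9 = ell D ^ 8 * ell D := by ring
  have e10 : ell D ^ 10 = ell D ^ 9 * ell D := by ring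
  have h9pos : 0 ≤ ell D ^ 9 := by positivity
  have hkey : ell D + 2 * ell D ^ 9 + 1058 * ell D + 4 * ell D ^ 9 + -(ell D ^ 10) / 8
      ≤ -(ell D ^ 10) / 16 := by
    nlinarith
  calc 1568 * Real.exp 1 * ((D : ℝ) * (x.p : ℝ) ^ 2) * ell D ^ 1048 * bigP D ^ 4 *
        (8 * ell D ^ 10 * Real.exp (-(ell D ^ 10) / 8))
      = 12544 * Real.exp 1 * ((D : ℝ) * (x.p : ℝ) ^ 2 * ell D ^ 1058 * bigP D ^ 4) *
          Real.exp (-(ell D ^ 10) / 8) := by ring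
    _ ≤ 12544 * Real.exp 1 * (Real.exp (ell D) * (9 * Real.exp (2 * ell D ^ 9)) *
          Real.exp (1058 * ell D) * Real.exp (4 * ell D ^ 9)) * Real.exp (-(ell D ^ 10) / 8) := by
        rw [hD, hP4]; gcongr
    _ = 112896 * Real.exp 1 *
          Real.exp (ell D + 2 * ell D ^ 9 + 1058 * ell D + 4 * ell D ^ 9 + -(ell D ^ 10) / 8) := by
        simp only [Real.exp_add]; ring
    _ ≤ 112896 * Real.exp 1 * Real.exp (-(ell D ^ 10) / 16) := by gcongr

/-- **The horizontal segments are `≪ ε`**: for `𝓛 ≥ 144`,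
`2e^{2𝓛⁹+1045𝓛}·P⁴·e^{1−𝓛¹⁰/4}·2 ≤ 4e·e^{−𝓛¹⁰/16}`. [cite: Zhang2022LandauSiegel, §4 (4.8) (proof) p. 20] -/
theorem horiz_prefactor_le (hℓ : 144 ≤ ell D) :
    2 * Real.exp (2 * ell D ^ 9 + 1045 * ell D) * bigP D ^ 4 * Real.exp (1 - ell D ^ 10 / 4) * 2
      ≤ 4 * Real.exp 1 * Real.exp (-(ell D ^ 10) / 16) := by
  have hℓ0 : 0 < ell D := by linarith
  have hP4 : bigP D ^ 4 = Real.exp (4 * ell D ^ 9) := by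
    rw [bigP, ← Real.exp_nat_mul]; norm_num
  have h8 : (1045 : ℝ) ≤ ell D ^ 8 := by
    calc (1045 : ℝ) ≤ 144 ^ 8 := by norm_num
      _ ≤ ell D ^ 8 := pow_le_pow_left₀ (by norm_num) hℓ 8
  have e9 : ell D ^ 9 = ell D ^ 8 * ell D := by ring
  have e10 : ell D ^ 10 = ell D ^ 9 * ell D := by ring
  have h9pos : 0 ≤ ell D ^ 9 := by positivity
  have hkey : 2 * ell D ^ 9 + 1045 * ell D + 4 * ell D ^ 9 + (1 - ell D ^ 10 / 4)
      ≤ 1 + -(ell D ^ 10) / 16 := by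
    nlinarith
  calc 2 * Real.exp (2 * ell D ^ 9 + 1045 * ell D) * bigP D ^ 4 * Real.exp (1 - ell D ^ 10 / 4) * 2
      = 4 * Real.exp (2 * ell D ^ 9 + 1045 * ell D + 4 * ell D ^ 9 + (1 - ell D ^ 10 / 4)) := by
        rw [hP4]; simp only [Real.exp_add]; ring
    _ ≤ 4 * Real.exp (1 + -(ell D ^ 10) / 16) := by gcongr
    _ = 4 * Real.exp 1 * Real.exp (-(ell D ^ 10) / 16) := by rw [Real.exp_add]; ring

end Prefactors

end Literature.NumberTheory.LFunctions.Zhang2022.Section4
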